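import Literature.Computability.Complexity.TableauRows
import Literature.Computability.Complexity.CfgCodesRead
import Literature.Computability.Complexity.CfgCodesFP
import Literature.Computability.Complexity.ExpTimeMaps
import Literature.Computability.Complexity.IterateFPPoly
import Literature.Computability.Complexity.LengthCompare
import HarnessLib

/-!
# The row language of a machine is in `EXP` (discharge of `Tableau.rowLang_mem_EXP`)

`TableauRows.lean` vendors, as the named fact `Tableau.rowLang_mem_EXP`, the step of the proof of
Meyer's theorem (Arora–Barak 2009, Thm. 6.20, p. 114) at which `EXP ⊆ P/poly` is applied to the
transcript of an exponential-time computation: the graph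
`RowLang M = {⟨x, ⟨T', ⟨J', c⟩⟩⟩ | c = codeVal (absVal (rowCfg M x ⟦T'⟧) ⟦J'⟧)}` of the map
"(input, row index, block index) ↦ block of the tableau row", indices in binary, is in `EXP` for
every machine `M : Turing.TM2ComputableAux Bool Bool` — the "universal TM with a time counter"
(Arora–Barak 2009, §1.4.1, Thm. 1.9) for one fixed machine. This file PROVES it
(`Tableau.rowLang_mem_EXP_holds`), assembling the tree's toolkit; no Turing machine is written:

* **codes.** `M` is replaced by its standard machine `sc M := TM2Std.stdCode M.tm`
  (`PolyTimeCountable.lean`; it follows the total run of `M`, `TM2Std.trCfg_iterate_stepTotal`,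
  `CfgCodesRead.lean`), whose configurations are the bit strings `CfgCodes.codeCfg`
  (`CfgCodesFP.lean`: block words `CfgCodes.encCfg` spelled by the unary block code); the block
  transductions `stepT` (one total step), `popT` (pop every stack, `CfgCodesRead.lean`), `normT`
  (initial code) and `firstT` (read the header) are the `FP` string functions `CfgCodes.stepFn`,
  `popFn`, `initFn`, `CfgCodes.firstFn` (`CfgCodes.bitsFn_mem_FP`), with
  `iterate_stepFn_initFn : stepFn^[t] (initFn x) = codeCfg (trCfg (rowCfg M x t))`;
  `CfgCodes.length_bitsFn_le` bounds every `bitsFn T` linearly on ALL inputs;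
* **loops.** `Brick.guardLoop q T` — the counted loop (`Brick.loopStep`, binary counter) of a
  string map `T` GUARDED by the length test `|state| ≤ q(|x|)` (`lenLeFn`), so that its rounds
  grow polynomially on every input and `Brick.loopFn_mem_FP_of_poly` applies
  (`guardLoop_mem_FP`); on intended inputs the guard never bites (`guardLoop_boolPair`);
* **the decider.** `rowFn M = answer ∘ loop₂ ∘ init₂ ∘ loop₁ ∘ init₁ ∈ FP` (`rowFn_mem_FP`): on a
  word `z` with `sndF z = ⟨x, ⟨T', ⟨J', c⟩⟩⟩`, lay out `⟨z, ⟨⌜⟦T'⟧⌝, initFn x⟩⟩`, run `⟦T'⟧`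
  guarded steps, reload the counter with `⟦J'⟧ - 1`, run that many guarded pops, and read block
  `⟦J'⟧` off the header (`gCtrl` for block `0`, `gCell` for the cells, decoding the standard
  machine's symbols back along `TM2Std.decOpt`); `rowFn_lpad`: on `z = lpad 1 w` (the
  linear-exponential pad of `ExpTimeMaps.lean`: `|z| ≥ 2^{|w|} > ⟦T'⟧, ⟦J'⟧` rounds, and `qM(|z|)`
  bounds every code met) `rowFn z` IS the code of the requested block;
* **the class.** `padRowLang M = {z | rowFn z = cOf z} ∈ P` (`setOf_apply_eq_apply_mem_P`),
  `lpad 1 ⁻¹' padRowLang M = RowLang M`, hence `RowLang M ∈ EXP` by `preimage_mem_EXP`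
  (`lpad 1 ∈ FE`, `ExpTimeMaps.lean`).

## References

* S. Arora, B. Barak, *Computational Complexity: A Modern Approach*, CUP 2009, Thm. 6.20 and its
  proof sketch (p. 114: "there is a `q(n)`-sized circuit `C` … that computes `zᵢ` from `i`"),
  §1.4.1 (p. 21: "a variant of the universal TM … that gets a number `T` as an extra input … by
  adding a time counter"), Thm. 1.9. doi:10.1017/cbo9780511804090 [AroraBarakCC2009]
* M. Sipser, *Introduction to the Theory of Computation*, 3rd ed., Cengage 2012, proof of
  Thm. 9.30 (rows and cells of a tableau). [Sipser2012]
-/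

noncomputable section

namespace Literature.Computability.Complexity

open Turing

/-! ### Linear length of block transductions on all bit strings -/

namespace CfgCodes

variable (c : TM2Std.SCode)

/-- **Every block transduction is linearly bounded on every bit string**: `|bitsFn T u| ≤ A |u| + B`
(three finite-state transducers, each of linear output length, `FST.length_eval_le`). [folklore] -/
theorem length_bitsFn_le {σ : Type} [Fintype σ] (T : FST σ (Blk c) (Blk c)) :
    ∃ A B : ℕ, ∀ u : List Bool, (bitsFn c T u).length ≤ A * u.length + B := by
  refine ⟨w c * (T.maxEmit * (decT c).maxEmit), w c * (T.maxEmit * (decT c).maxFront + T.maxFront), fun u => ?_⟩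
  have h1 := (decT c).length_eval_le u
  have h2 := T.length_eval_le ((decT c).eval u)
  have h3 := length_flatMap_code_le c (T.eval ((decT c).eval u))
  have h4 : T.maxEmit * ((decT c).eval u).length ≤ T.maxEmit * ((decT c).maxEmit * u.length + (decT c).maxFront) :=
    Nat.mul_le_mul_left _ h1
  have h5 : w c * (T.eval ((decT c).eval u)).length ≤
      w c * (T.maxEmit * ((decT c).maxEmit * u.length + (decT c).maxFront) + T.maxFront) :=
    Nat.mul_le_mul_left _ (h2.trans (by omega))
  rw [bitsFn]
  refine h3.trans (h5.trans (le_of_eq ?_))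
  ring

end CfgCodes

/-! ### Guarded counted loops of a string map -/

namespace Brick

open Polynomial _root_.Computability

variable (q : Polynomial ℕ) (T : List Bool → List Bool)

/-- The guard of a guarded loop on records `⟨x, ⟨counter, s⟩⟩`: the bit `[|s| ≤ q(|x|)]`
(`lenLeFn`). [folklore] -/
def guardTest : List Bool → List Bool := lenLeFn q ∘ fanoutFn (nthF 0) (sndPow 1)

/-- The guard computes `[|sndPow 1 z| ≤ q(|fstF z|)]` on every input. [folklore] -/
theorem guardTest_apply (z : List Bool) :
    guardTest q z = [decide ((sndPow 1 z).length ≤ q.eval (fstF z).length)] := by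
  simp [guardTest, lenLeFn_boolPair]

/-- `guardTest q ∈ FP`. [folklore] -/
theorem guardTest_mem_FP : guardTest q ∈ FP :=
  comp_mem_FP (lenLeFn_mem_FP q) (fanoutFn_mem_FP (nthF_mem_FP 0) (sndPow_mem_FP 1))

/-- **The guarded body**: replace the state `s` by `T s` if `|s| ≤ q(|x|)`, else keep it (so that
the growth per round is bounded on EVERY input, whatever `T` does to long or malformed states).
[cite: AroraBarakCC2009, §1.3 (bounded loops)] -/
def guardBody : List Bool → List Bool := iteFn (guardTest q) (T ∘ sndPow 1) (sndPow 1)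

/-- `guardBody q T ∈ FP` for `T ∈ FP`. [folklore] -/
theorem guardBody_mem_FP (hT : T ∈ FP) : guardBody q T ∈ FP :=
  iteFn_mem_FP (guardTest_mem_FP q) (comp_mem_FP hT (sndPow_mem_FP 1)) (sndPow_mem_FP 1)

/-- The guarded body, evaluated. [folklore] -/
theorem guardBody_apply (z : List Bool) :
    guardBody q T z = if (sndPow 1 z).length ≤ q.eval (fstF z).length then T (sndPow 1 z) else sndPow 1 z := by
  unfold guardBody
  by_cases h : (sndPow 1 z).length ≤ q.eval (fstF z).length
  · rw [iteFn_apply_true (by rw [guardTest_apply, decide_eq_true h]), if_pos h]; rfl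
  · rw [iteFn_apply_false (by rw [guardTest_apply, decide_eq_false h]), if_neg h]

/-- The guarded body on a record. [folklore] -/
theorem guardBody_boolPair (x cnt s : List Bool) :
    guardBody q T (boolPair x (boolPair cnt s)) = if s.length ≤ q.eval x.length then T s else s := by
  rw [guardBody_apply]; simp

/-- **Growth of the guarded body**: if `|T u| ≤ A |u| + B` on every input then
`|guardBody q T z| ≤ |sndPow 1 z| + (A q + B)(|fstF z|)`. [folklore] -/
theorem length_guardBody_le {A B : ℕ} (hT : ∀ u, (T u).length ≤ A * u.length + B) (z : List Bool) :
    (guardBody q T z).length ≤ (sndPow 1 z).length + (C A * q + C B).eval (fstF z).length := by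
  rw [guardBody_apply]
  simp only [eval_add, eval_mul, eval_C]
  split_ifs with h
  · have h1 := hT (sndPow 1 z)
    have h2 : A * (sndPow 1 z).length ≤ A * q.eval (fstF z).length := Nat.mul_le_mul_left _ h
    omega
  · omega

/-- **The guarded counted loop** of `T`: `|x|` rounds of `loopStep (guardBody q T)` on the record
`z = ⟨x, ⟨counter, s⟩⟩`. [cite: AroraBarakCC2009, §1.4.1 (a step counter drives the loop)] -/
def guardLoop : List Bool → List Bool := fun z => (loopStep (guardBody q T))^[(fstF z).length] z

/-- **`guardLoop q T ∈ FP`** for `T ∈ FP` of linear length (`Brick.loopFn_mem_FP_of_poly`).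
[cite: AroraBarakCC2009, §1.3 and §1.4.1] -/
theorem guardLoop_mem_FP (hT : T ∈ FP) {A B : ℕ} (hlen : ∀ u, (T u).length ≤ A * u.length + B) :
    guardLoop q T ∈ FP := by
  have h := loopFn_mem_FP_of_poly (guardBody_mem_FP q T hT) (C A * q + C B) (length_guardBody_le q T hlen) X
  simp only [eval_X] at h
  exact h

/-- The model of the guarded loop is plain iteration of `T` as long as the guard holds. [folklore] -/
theorem loopModel_guardBody (x : List Bool) : ∀ (k : ℕ) (s : List Bool),
    (∀ i, i < k → (T^[i] s).length ≤ q.eval x.length) → loopModel (guardBody q T) x k s = T^[k] s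
  | 0, _, _ => rfl
  | k + 1, s, h => by
    rw [loopModel, guardBody_boolPair, if_pos (by simpa using h 0 (Nat.succ_pos _)),
      loopModel_guardBody x k (T s) (fun i hi => by
        rw [← Function.iterate_succ_apply]; exact h (i + 1) (by omega)),
      Function.iterate_succ_apply]

/-- **Semantics of the guarded loop**: started at counter `k ≤ |x|` on a state whose first `k`
iterates under `T` stay within the guard, it ends at counter `0` with state `T^[k] s`.
[cite: AroraBarakCC2009, §1.4.1] -/
theorem guardLoop_boolPair (x s : List Bool) (k : ℕ) (hk : k ≤ x.length)
    (h : ∀ i, i < k → (T^[i] s).length ≤ q.eval x.length) :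
    guardLoop q T (boolPair x (boolPair (encodeNat k) s)) = boolPair x (boolPair [] (T^[k] s)) := by
  unfold guardLoop
  rw [fstF_boolPair, iterate_loopStep _ x k x.length s hk, loopModel_guardBody q T x k s h]

end Brick

namespace Tableau

open TM2Std TM2Sim CfgCodes Brick Polynomial _root_.Computability

variable (M : TM2ComputableAux Bool Bool)

/-! ### The standard machine of `M`: steps, pops, initial codes and the header as string functions -/

/-- The standard machine simulating `M.tm` (`TM2Std.stdCode`). [cite: AroraBarakCC2009, §1.4] -/
abbrev sc : SCode := stdCode M.tm

/-- **The pop function on bit codes** (the popping transducer `CfgCodes.popT` on bit strings).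
[cite: AroraBarakCC2009, Thm. 6.20 (proof)] -/
def popFn : List Bool → List Bool := bitsFn (sc M) (popT (sc M))

/-- `popFn ∈ FP`. [folklore] -/
theorem popFn_mem_FP : popFn M ∈ FP := bitsFn_mem_FP _ _

/-- One pop on bit codes. [folklore] -/
theorem popFn_codeCfg (x : (sc M).tm.Cfg) : popFn M (codeCfg (sc M) x) = codeCfg (sc M) (popΦ (sc M) x) := by
  rw [popFn, codeCfg, bitsFn_flatMap_code, popT_eval_encCfg, codeCfg]

/-- **Iterated pops on bit codes drop symbols from every stack.** [cite: AroraBarakCC2009, Thm. 6.20 (proof)] -/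
theorem iterate_popFn_codeCfg (x : (sc M).tm.Cfg) (n : ℕ) :
    (popFn M)^[n] (codeCfg (sc M) x) = codeCfg (sc M) ⟨x.l, x.var, fun k => (x.stk k).drop n⟩ := by
  induction n generalizing x with
  | zero => obtain ⟨l, v, S⟩ := x; simp
  | succ n ih =>
    rw [Function.iterate_succ_apply, popFn_codeCfg, ih]
    simp only [popΦ, List.drop_drop]
    congr 2
    funext k
    rw [Nat.add_comm 1 n]

/-- The code of an input bit as a symbol of the standard machine. [folklore] -/
def ι (b : Bool) : CfgCodes.Sym (sc M) := TM2Std.enc M.tm ⟨M.tm.k₀, M.inputAlphabet.symm b⟩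

/-- The coded input word is the standard machine's input. [folklore] -/
theorem map_ι (x : List Bool) : x.map (ι M) = stkCode M.tm M.tm.k₀ (x.map M.inputAlphabet.symm) := by
  simp [ι, stkCode]

/-- The fixed prefix of initial codes: the empty header and `nK` separators, in bits. [folklore] -/
def preBits : List Bool :=
  code (sc M) (Blk.hdr (some (sc M).main) (sc M).init (toWin (sc M) fun _ => [])) ++
    (List.replicate (sc M).nK (code (sc M) Blk.sep)).flatten

/-- **The initial code as a string function**: the fixed prefix, the coded input symbols, then
the normaliser `CfgCodes.normFn`. [cite: AroraBarakCC2009, §1.4] -/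
def initFn : List Bool → List Bool :=
  normFn (sc M) ∘ fun x => preBits M ++ x.flatMap fun b => code (sc M) (Blk.sym (ι M b))

/-- `initFn ∈ FP`. [folklore] -/
theorem initFn_mem_FP : initFn M ∈ FP := comp_mem_FP (normFn_mem_FP _) (preMap_mem_FP _ _)

/-- **`initFn x` is the bit code of the initial configuration on `x`.** [cite: AroraBarakCC2009, §1.4] -/
theorem initFn_apply (x : List Bool) :
    initFn M x = codeCfg (sc M) (initList (sc M).tm (x.map (ι M))) := by
  have hsp : preBits M ++ x.flatMap (fun b => code (sc M) (Blk.sym (ι M b))) =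
      codePre (sc M) (some (sc M).main) (sc M).init (Function.update (fun _ => []) (sc M).k₀ (x.map (ι M))) := by
    rw [codePre_update_k₀, preBits, List.flatMap_map]
  unfold initFn
  rw [Function.comp_apply, hsp, normFn_codePre, TM2Comp.initList_eq]

/-- Configuration `t` of the standard machine on the coded input `x`. [folklore] -/
def cfgStd (x : List Bool) (t : ℕ) : (sc M).tm.Cfg :=
  (stepTotal (sc M).tm)^[t] (initList (sc M).tm (x.map (ι M)))

/-- It is the code of row `t` of the run of `M` on `x`. [cite: AroraBarakCC2009, §1.4] -/
theorem cfgStd_eq (x : List Bool) (t : ℕ) : cfgStd M x t = trCfg M.tm (rowCfg M x t) := by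
  rw [cfgStd, map_ι, iterate_stepTotal_initList_stkCode]
  rfl

/-- **Row `t` of the run of `M` on `x`, in bits**: `t` steps of `stepFn` from `initFn x` give the
bit code of the coded configuration `trCfg (rowCfg M x t)`.
[cite: AroraBarakCC2009, Thm. 6.20 (proof: the snapshot `zᵢ`)] -/
theorem iterate_stepFn_initFn (x : List Bool) (t : ℕ) :
    (stepFn (sc M))^[t] (initFn M x) = codeCfg (sc M) (cfgStd M x t) := by
  rw [initFn_apply, iterate_stepFn_codeCfg, cfgStd]

/-! ### Reading a block of a row off the header of a (popped) code -/

/-- **Control read-out**: on a header, the code of the block value `((label, state), empty cell)`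
(label and state renumbered back along `eΛ`, `eσ`). [cite: AroraBarakCC2009, Thm. 6.20 (proof)] -/
def gCtrl : Blk (sc M) → List Bool
  | Blk.hdr l v _ => codeVal M.tm ((l.map (eΛ M.tm).symm, (eσ M.tm).symm v), noneCell M.tm)
  | _ => []

/-- The control read-out of a coded configuration is the code of block `0` of its row. [folklore] -/
theorem gCtrl_trCfg (y : M.tm.Cfg) (W : Win (sc M)) :
    gCtrl M (Blk.hdr (trCfg M.tm y).l (trCfg M.tm y).var W) = codeVal M.tm (absVal y 0) := by
  rw [absVal_zero, gCtrl, trCfg_l, trCfg_var, Option.map_map, Equiv.symm_apply_apply,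
    Equiv.symm_comp_self, Option.map_id]
  rfl

/-- **Cell read-out**: on a header, the code of the block value `(default, cell)` whose cell is
read off the tops of the window (decoded along `decOpt`, restricted to the effective alphabet by
`toSym`). [cite: AroraBarakCC2009, Thm. 6.20 (proof)] -/
def gCell : Blk (sc M) → List Bool
  | Blk.hdr _ _ W => codeVal M.tm (default, fun k =>
      (decOpt M.tm k (W (eK M.tm k) ⟨0, one_le_D (sc M)⟩)).bind (FinTM2Sim.toSym M.tm k))
  | _ => []

/-- The cell read-out of a coded configuration popped `i` times is the code of block `i + 1` of
its row (the symbols being allowed, they decode). [folklore] -/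
theorem gCell_drop {y : M.tm.Cfg} (hy : StkOK M.tm y.stk) (i : ℕ) (l : Option (Fin (sc M).nΛ))
    (v : Fin (sc M).nσ) :
    gCell M (Blk.hdr l v (toWin (sc M) fun k' => ((trCfg M.tm y).stk k').drop i)) =
      codeVal M.tm (absVal y (i + 1)) := by
  rw [absVal_succ, gCell]
  congr 2
  funext k
  rw [toWin_zero]
  change (decOpt M.tm k ((((trCfg M.tm y).stk (eK M.tm k)).drop i)[0]?)).bind _ = cellAt y.stk i k
  rw [List.getElem?_drop, show i + 0 = i from rfl, getElem?_trCfg_stk, cellAt]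
  cases h : (y.stk k)[i]? with
  | none => rfl
  | some γ =>
    rw [Option.map_some, decOpt_enc M.tm (hy k γ (List.mem_of_getElem? h))]

/-! ### The decider of the padded row language -/

/-- **The guard polynomial**: `w · nK · (1 + depth) · n + w · (1 + nK)` bounds the bit codes of
all configurations of runs of at most `n` steps from inputs of length at most `n`, and of their
popped versions. [folklore] -/
def qM : Polynomial ℕ :=
  C (w (sc M) * ((sc M).nK * (1 + depth (sc M).tm))) * X + C (w (sc M) * (1 + (sc M).nK))

/-- Evaluation of the guard polynomial. [folklore] -/
theorem qM_eval (n : ℕ) :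
    (qM M).eval n = w (sc M) * ((sc M).nK * (1 + depth (sc M).tm)) * n + w (sc M) * (1 + (sc M).nK) := by
  simp [qM]

/-- Stack heights of the standard run. [folklore] -/
theorem length_cfgStd_stk_le (x : List Bool) (t : ℕ) (k : Fin (sc M).nK) :
    ((cfgStd M x t).stk k).length ≤ x.length + depth (sc M).tm * t := by
  have h1 := length_iterate_stepTotal_le (sc M).tm (initList (sc M).tm (x.map (ι M))) k t
  have h2 : ((initList (sc M).tm (x.map (ι M))).stk k).length ≤ x.length := by
    rw [TM2Comp.initList_eq]
    dsimp only
    by_cases hk : k = (sc M).k₀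
    · subst hk; rw [Function.update_self, List.length_map]
    · rw [Function.update_of_ne hk]; exact Nat.zero_le _
  unfold cfgStd
  omega

/-- **The guard holds along the run**: for `t ≤ n`, `|x| ≤ n`, the bit code of configuration `t`
popped `j` times has length at most `qM(n)`. [folklore] -/
theorem length_codeCfg_drop_le {x : List Bool} {t n : ℕ} (ht : t ≤ n) (hx : x.length ≤ n) (j : ℕ) :
    (codeCfg (sc M) ⟨(cfgStd M x t).l, (cfgStd M x t).var, fun k => ((cfgStd M x t).stk k).drop j⟩).length ≤
      (qM M).eval n := by
  rw [qM_eval]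
  refine (length_codeCfg_le (sc M) _).trans ?_
  have h2 : ∑ k, (((cfgStd M x t).stk k).drop j).length ≤ ∑ _k : Fin (sc M).nK, (n + depth (sc M).tm * n) :=
    Finset.sum_le_sum fun k _ => by
      have h3 := length_cfgStd_stk_le M x t k
      have h4 : depth (sc M).tm * t ≤ depth (sc M).tm * n := Nat.mul_le_mul_left _ ht
      rw [List.length_drop]
      omega
  rw [Finset.sum_const, Finset.card_univ, Fintype.card_fin, smul_eq_mul] at h2
  calc w (sc M) * (1 + (sc M).nK + ∑ k, (((cfgStd M x t).stk k).drop j).length)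
      ≤ w (sc M) * (1 + (sc M).nK + (sc M).nK * (n + depth (sc M).tm * n)) :=
        Nat.mul_le_mul_left _ (Nat.add_le_add_left h2 _)
    _ = w (sc M) * ((sc M).nK * (1 + depth (sc M).tm)) * n + w (sc M) * (1 + (sc M).nK) := by ring

/-- The unpopped case. [folklore] -/
theorem length_codeCfg_cfgStd_le {x : List Bool} {t n : ℕ} (ht : t ≤ n) (hx : x.length ≤ n) :
    (codeCfg (sc M) (cfgStd M x t)).length ≤ (qM M).eval n := by
  have h := length_codeCfg_drop_le M ht hx 0
  have he : (⟨(cfgStd M x t).l, (cfgStd M x t).var, fun k => ((cfgStd M x t).stk k).drop 0⟩ : (sc M).tm.Cfg) =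
      cfgStd M x t := by
    rcases cfgStd M x t with ⟨l, v, S⟩
    rfl
  rwa [he] at h

/-- The instance `w = ⟨x, ⟨T', ⟨J', c⟩⟩⟩` sits in the second component of the padded word `z`;
its input field `x`. [folklore] -/
def xOf : List Bool → List Bool := nthF 0 ∘ sndF

/-- The time field `T'` of the instance. [folklore] -/
def tOf : List Bool → List Bool := nthF 1 ∘ sndF

/-- The block-index field `J'` of the instance. [folklore] -/
def jOf : List Bool → List Bool := nthF 2 ∘ sndF

/-- The claimed-code field `c` of the instance. [folklore] -/
def cOf : List Bool → List Bool := sndPow 2 ∘ sndF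

/-- `cOf ∈ FP`. [folklore] -/
theorem cOf_mem_FP : cOf ∈ FP := comp_mem_FP (sndPow_mem_FP 2) sndF_mem_FP

/-- **Stage 1**: lay out the loop record `⟨z, ⟨⌜⟦T'⟧⌝, initial bit code on x⟩⟩` (the counter in
canonical binary, `subFn` with subtrahend `0`). [cite: AroraBarakCC2009, §1.4.1] -/
def init₁ : List Bool → List Bool :=
  fanoutFn id (fanoutFn (subFn ∘ fanoutFn tOf fun _ => []) (initFn M ∘ xOf))

/-- **Stage 2**: the clocked simulation loop (`⟦T'⟧` guarded steps). [cite: AroraBarakCC2009, §1.4.1] -/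
def loop₁ : List Bool → List Bool := guardLoop (qM M) (stepFn (sc M))

/-- **Stage 3**: reload the counter with `⟦J'⟧ - 1` for the popping loop. [cite: AroraBarakCC2009, Thm. 6.20 (proof)] -/
def init₂ : List Bool → List Bool :=
  fanoutFn fstF (fanoutFn (subFn ∘ fanoutFn (jOf ∘ fstF) fun _ => [true]) (sndPow 1))

/-- **Stage 4**: the popping loop (`⟦J'⟧ - 1` guarded pops). [cite: AroraBarakCC2009, Thm. 6.20 (proof)] -/
def loop₂ : List Bool → List Bool := guardLoop (qM M) (popFn M)

/-- The test `[⟦J'⟧ = 0]` on the final record. [folklore] -/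
def jZero : List Bool → List Bool := isNilFn ∘ subFn ∘ fanoutFn (jOf ∘ fstF) fun _ => []

/-- **Stage 5**: read the block off the header — the control block if `⟦J'⟧ = 0`, else the cell.
[cite: AroraBarakCC2009, Thm. 6.20 (proof)] -/
def answer : List Bool → List Bool :=
  iteFn jZero (firstFn (sc M) (gCtrl M) ∘ sndPow 1) (firstFn (sc M) (gCell M) ∘ sndPow 1)

/-- **The row function**: on the padded word `z = lpad 1 w`, `w = ⟨x, ⟨T', ⟨J', c⟩⟩⟩`, it computes
the code of block `⟦J'⟧` of row `⟦T'⟧` of the run of `M` on `x` (`rowFn_lpad`).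
[cite: AroraBarakCC2009, Thm. 6.20 (proof: computing `zᵢ` from `i`)] -/
def rowFn : List Bool → List Bool := answer M ∘ loop₂ M ∘ init₂ ∘ loop₁ M ∘ init₁ M

/-- **`rowFn ∈ FP`.** [cite: AroraBarakCC2009, Thm. 1.9 (proof) and §1.4.1] -/
theorem rowFn_mem_FP : rowFn M ∈ FP := by
  have h1 : init₁ M ∈ FP :=
    fanoutFn_mem_FP (PolyTimeComputable.id (id : List Bool → List Bool)) (fanoutFn_mem_FP
      (comp_mem_FP subFn_mem_FP (fanoutFn_mem_FP (comp_mem_FP (nthF_mem_FP 1) sndF_mem_FP) (const_mem_FP _)))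
      (comp_mem_FP (initFn_mem_FP M) (comp_mem_FP (nthF_mem_FP 0) sndF_mem_FP)))
  have h2 : loop₁ M ∈ FP := by
    obtain ⟨A, B, hAB⟩ := length_bitsFn_le (sc M) (stepT (sc M))
    exact guardLoop_mem_FP _ _ (stepFn_mem_FP (sc M)) hAB
  have hj : (jOf ∘ fstF) ∈ FP := comp_mem_FP (comp_mem_FP (nthF_mem_FP 2) sndF_mem_FP) fstF_mem_FP
  have h3 : init₂ ∈ FP :=
    fanoutFn_mem_FP fstF_mem_FP (fanoutFn_mem_FP
      (comp_mem_FP subFn_mem_FP (fanoutFn_mem_FP hj (const_mem_FP _))) (sndPow_mem_FP 1))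
  have h4 : loop₂ M ∈ FP := by
    obtain ⟨A, B, hAB⟩ := length_bitsFn_le (sc M) (popT (sc M))
    exact guardLoop_mem_FP _ _ (popFn_mem_FP M) hAB
  have h5 : answer M ∈ FP :=
    iteFn_mem_FP (comp_mem_FP isNilFn_mem_FP (comp_mem_FP subFn_mem_FP (fanoutFn_mem_FP hj (const_mem_FP _))))
      (comp_mem_FP (firstFn_mem_FP _ _) (sndPow_mem_FP 1)) (comp_mem_FP (firstFn_mem_FP _ _) (sndPow_mem_FP 1))
  exact comp_mem_FP h5 (comp_mem_FP h4 (comp_mem_FP h3 (comp_mem_FP h2 h1)))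

/-- **The padded row language** `{z | rowFn z = cOf z}`. [cite: AroraBarakCC2009, Thm. 6.20 (proof)] -/
def padRowLang : Language Bool := {z | rowFn M z = cOf z}

/-- **`padRowLang M ∈ P`** (an equality test of two `FP` maps). [cite: AroraBarakCC2009, Thm. 6.20 (proof) and §1.4.1] -/
theorem padRowLang_mem_P : padRowLang M ∈ Classes.P :=
  setOf_apply_eq_apply_mem_P (rowFn_mem_FP M) cOf_mem_FP

/-! ### Correctness on padded words -/

/-- **The row function on a padded word.** For every `w`, with `x, T', J'` its fields read through
`boolUnpair` (as in `IsRow`), `rowFn (lpad 1 w)` is the code of block `⟦J'⟧` of row `⟦T'⟧` of the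
run of `M` on `x`: the pad gives `|z| ≥ 2^{|w|} > ⟦T'⟧, ⟦J'⟧` rounds to both loops and room
`qM(|z|)` to every code met. [cite: AroraBarakCC2009, Thm. 6.20 (proof) and §1.4.1] -/
theorem rowFn_lpad (w : List Bool) :
    rowFn M (lpad 1 w) = codeVal M.tm (absVal (rowCfg M (boolUnpair w).1 (bitsToNat (boolUnpair (boolUnpair w).2).1))
      (bitsToNat (boolUnpair (boolUnpair (boolUnpair w).2).2).1)) := by
  -- sizes: the pad is long enough for both loops and all codes
  have hzw : sndF (lpad 1 w) = w := boolUnpair_lpad_snd 1 w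
  have hlenz : 2 ^ w.length ≤ (lpad 1 w).length := by simpa using two_pow_le_length_lpad 1 w
  have hw1 := length_boolUnpair_parts_le w
  have hw2 := length_boolUnpair_parts_le (boolUnpair w).2
  have hw3 := length_boolUnpair_parts_le (boolUnpair (boolUnpair w).2).2
  have hwlt : w.length < 2 ^ w.length := Nat.lt_two_pow_self
  have hxz : (boolUnpair w).1.length ≤ (lpad 1 w).length := by omega
  have htz : bitsToNat (boolUnpair (boolUnpair w).2).1 ≤ (lpad 1 w).length := by
    have h1 := bitsToNat_lt (boolUnpair (boolUnpair w).2).1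
    have h2 : 2 ^ (boolUnpair (boolUnpair w).2).1.length ≤ 2 ^ w.length :=
      Nat.pow_le_pow_right Nat.two_pos (by omega)
    omega
  have hJz : bitsToNat (boolUnpair (boolUnpair (boolUnpair w).2).2).1 - 1 ≤ (lpad 1 w).length := by
    have h1 := bitsToNat_lt (boolUnpair (boolUnpair (boolUnpair w).2).2).1
    have h2 : 2 ^ (boolUnpair (boolUnpair (boolUnpair w).2).2).1.length ≤ 2 ^ w.length :=
      Nat.pow_le_pow_right Nat.two_pos (by omega)
    omega
  -- the fields of the instance
  have hxOf : xOf (lpad 1 w) = (boolUnpair w).1 := by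
    simp only [xOf, Function.comp_apply, hzw]; rfl
  have htOf : tOf (lpad 1 w) = (boolUnpair (boolUnpair w).2).1 := by
    simp only [tOf, Function.comp_apply, hzw]; rfl
  have hjOf : jOf (lpad 1 w) = (boolUnpair (boolUnpair (boolUnpair w).2).2).1 := by
    simp only [jOf, Function.comp_apply, hzw]; rfl
  -- stage 1
  have h1 : init₁ M (lpad 1 w) = boolPair (lpad 1 w) (boolPair (encodeNat (bitsToNat (boolUnpair (boolUnpair w).2).1))
      (initFn M (boolUnpair w).1)) := by
    simp [init₁, hxOf, htOf]
  -- stage 2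
  have h2 : loop₁ M (boolPair (lpad 1 w) (boolPair (encodeNat (bitsToNat (boolUnpair (boolUnpair w).2).1))
      (initFn M (boolUnpair w).1))) = boolPair (lpad 1 w) (boolPair []
        (codeCfg (sc M) (cfgStd M (boolUnpair w).1 (bitsToNat (boolUnpair (boolUnpair w).2).1)))) := by
    rw [loop₁, guardLoop_boolPair _ _ (lpad 1 w) _ _ htz, iterate_stepFn_initFn]
    intro i hi
    rw [iterate_stepFn_initFn]
    exact length_codeCfg_cfgStd_le M (by omega) hxz
  -- stage 3
  have h3 : init₂ (boolPair (lpad 1 w) (boolPair []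
      (codeCfg (sc M) (cfgStd M (boolUnpair w).1 (bitsToNat (boolUnpair (boolUnpair w).2).1))))) =
      boolPair (lpad 1 w) (boolPair (encodeNat (bitsToNat (boolUnpair (boolUnpair (boolUnpair w).2).2).1 - 1))
        (codeCfg (sc M) (cfgStd M (boolUnpair w).1 (bitsToNat (boolUnpair (boolUnpair w).2).1)))) := by
    simp [init₂, hjOf]
  -- stage 4
  have h4 : loop₂ M (boolPair (lpad 1 w) (boolPair
      (encodeNat (bitsToNat (boolUnpair (boolUnpair (boolUnpair w).2).2).1 - 1))
        (codeCfg (sc M) (cfgStd M (boolUnpair w).1 (bitsToNat (boolUnpair (boolUnpair w).2).1))))) =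
      boolPair (lpad 1 w) (boolPair [] (codeCfg (sc M)
        ⟨(cfgStd M (boolUnpair w).1 (bitsToNat (boolUnpair (boolUnpair w).2).1)).l,
         (cfgStd M (boolUnpair w).1 (bitsToNat (boolUnpair (boolUnpair w).2).1)).var,
         fun k => ((cfgStd M (boolUnpair w).1 (bitsToNat (boolUnpair (boolUnpair w).2).1)).stk k).drop
           (bitsToNat (boolUnpair (boolUnpair (boolUnpair w).2).2).1 - 1)⟩)) := by
    rw [loop₂, guardLoop_boolPair _ _ (lpad 1 w) _ _ hJz, iterate_popFn_codeCfg]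
    intro i _
    rw [iterate_popFn_codeCfg]
    exact length_codeCfg_drop_le M htz hxz i
  -- stage 5
  have hstk : StkOK M.tm (rowCfg M (boolUnpair w).1 (bitsToNat (boolUnpair (boolUnpair w).2).1)).stk :=
    stkOK_iterate_stepTotal M.tm (stkOK_initList M.tm _) _
  have h5 : answer M (boolPair (lpad 1 w) (boolPair [] (codeCfg (sc M)
        ⟨(cfgStd M (boolUnpair w).1 (bitsToNat (boolUnpair (boolUnpair w).2).1)).l,
         (cfgStd M (boolUnpair w).1 (bitsToNat (boolUnpair (boolUnpair w).2).1)).var,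
         fun k => ((cfgStd M (boolUnpair w).1 (bitsToNat (boolUnpair (boolUnpair w).2).1)).stk k).drop
           (bitsToNat (boolUnpair (boolUnpair (boolUnpair w).2).2).1 - 1)⟩))) =
      codeVal M.tm (absVal (rowCfg M (boolUnpair w).1 (bitsToNat (boolUnpair (boolUnpair w).2).1))
        (bitsToNat (boolUnpair (boolUnpair (boolUnpair w).2).2).1)) := by
    have henc : ∀ n : ℕ, encodeNat n = [] ↔ n = 0 := fun n =>
      ⟨fun h => by simpa [h] using (bitsToNat_encodeNat n).symm, fun h => by subst h; rfl⟩
    have htest : ∀ s : List Bool, jZero (boolPair (lpad 1 w) (boolPair [] s)) =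
        [decide (bitsToNat (boolUnpair (boolUnpair (boolUnpair w).2).2).1 = 0)] := by
      intro s
      simp [jZero, hjOf, isNilFn, henc]
    rcases Nat.eq_zero_or_pos (bitsToNat (boolUnpair (boolUnpair (boolUnpair w).2).2).1) with hJ0 | hJpos
    · rw [answer, iteFn_apply_true (by rw [htest, hJ0]; rfl)]
      simp only [Function.comp_apply, sndPow_succ_boolPair, sndPow_zero_boolPair]
      rw [firstFn_codeCfg, hJ0, cfgStd_eq]
      exact gCtrl_trCfg M _ _
    · obtain ⟨j, hj⟩ : ∃ j, bitsToNat (boolUnpair (boolUnpair (boolUnpair w).2).2).1 = j + 1 :=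
        ⟨bitsToNat (boolUnpair (boolUnpair (boolUnpair w).2).2).1 - 1, by omega⟩
      rw [answer, iteFn_apply_false (by rw [htest, hj]; rfl)]
      simp only [Function.comp_apply, sndPow_succ_boolPair, sndPow_zero_boolPair]
      rw [firstFn_codeCfg, hj, Nat.add_sub_cancel, cfgStd_eq]
      exact gCell_drop M hstk j _ _
  -- assemble
  simp only [rowFn, Function.comp_apply]
  rw [h1, h2, h3, h4, h5]

/-- **The padded row language pulls back to the row language**: `lpad 1 ⁻¹' padRowLang M = RowLang M`.
[cite: AroraBarakCC2009, Thm. 6.20 (proof)] -/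
theorem preimage_lpad_padRowLang : (lpad 1 ⁻¹' padRowLang M : Language Bool) = RowLang M := by
  ext w
  change rowFn M (lpad 1 w) = cOf (lpad 1 w) ↔ IsRow M w
  have hc : cOf (lpad 1 w) = (boolUnpair (boolUnpair (boolUnpair w).2).2).2 := by
    have hzw : sndF (lpad 1 w) = w := boolUnpair_lpad_snd 1 w
    simp only [cOf, Function.comp_apply, hzw]
    rfl
  rw [rowFn_lpad, hc, IsRow, eq_comm]

/-- **Discharge of `Tableau.rowLang_mem_EXP`: the row language of every machine is in `EXP`.**
On `w = ⟨x, ⟨T', ⟨J', c⟩⟩⟩` pad to length `≥ 2^{|w|}` (`lpad 1 ∈ FE`, `ExpTimeMaps.lean`), then run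
the polynomial-time decider of the padded row language — the clocked simulation of the standard
machine of `M` for `⟦T'⟧` steps on bit-coded configurations, `⟦J'⟧ - 1` pops, and a read of the
header — and conclude by `preimage_mem_EXP` (`g⁻¹(A) ∈ EXP` for `g ∈ FE`, `A ∈ P`). This is the
"universal TM with a time counter" of Arora–Barak 2009, §1.4.1 / Thm. 1.9, for one fixed machine,
at the point of the proof of Thm. 6.20 where `EXP ⊆ P/poly` is applied to the map `i ↦ zᵢ`.
[cite: AroraBarakCC2009, Thm. 6.20 (proof, p. 114) and §1.4.1] -/
theorem rowLang_mem_EXP_holds : rowLang_mem_EXP := by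
  intro M
  rw [← preimage_lpad_padRowLang M]
  exact preimage_mem_EXP (lpad_mem_FE 1) (padRowLang_mem_P M)

end Tableau

end Literature.Computability.Complexity

end
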